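import Mathlib
import HarnessLib

/-!
# A Turán-type counting lemma (for the planar cell calibration of crux `TwoProducts`, stmt-ValiantsHypothesis-5906)

Elementary extremal lemma used by `…TwoProductsPlanarCellTwoCoin.lean` (val-lit-p3 g13): if every pairwise-GOOD subset of a
finite set `X` (for a symmetric relation `bad`) has at most `4` elements, then `(#X − 4)² ≤ 8 · #{(x,y) ∈ X² : x ≠ y, bad x y}`
(`sq_le_card_badPairs`).  Proof: peel a maximal good set `I` (`#I ≤ 4`); by maximality every point outside `I` has a bad partner
inside `I`, giving `#(X ∖ I)` ordered bad pairs with second coordinate in `I`, disjoint from the bad pairs inside `X ∖ I`; induct.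
(Turán's theorem for `K₅`-free complements would give the same order; this self-contained version avoids the graph library.)
Honest framing: pure combinatorics; nothing here is about `VP ≠ VNP` (NOT proved).  No named facts. [folklore]
-/

-- Sub = Summit single-conjunct layout: the duplicated namespace component is mandated by the tree.
set_option linter.dupNamespace false

namespace Summit.ValiantsHypothesis.ValiantsHypothesis.Theorems.NewtonUnitEquations.TwoProducts.PlanarCell

/-! ## Turán-lite: if pairwise-good sets have at most four elements, bad pairs are quadratically many -/

/-- Arithmetic of the peeling step (`n'` = size after peeling a good set of size `k ≤ 4`). [folklore] -/
theorem peel_arith (n' k B' : ℕ) (hk4 : k ≤ 4)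
    (ih : (n' - 4) * (n' - 4) ≤ 8 * B') : (n' + k - 4) * (n' + k - 4) ≤ 8 * (n' + B') := by
  rcases Nat.lt_or_ge n' 4 with h | h
  · interval_cases n' <;> interval_cases k <;> omega
  · obtain ⟨a, rfl⟩ : ∃ a, n' = a + 4 := ⟨n' - 4, by omega⟩
    rw [Nat.add_sub_cancel] at ih
    have e : a + 4 + k - 4 = a + k := by omega
    rw [e]
    nlinarith

/-- **Turán-lite.**  If every pairwise-good subset of `X` has at most `4` elements (for a symmetric relation `bad`), then
`(#X − 4)² ≤ 8 · #{(x, y) ∈ X² : x ≠ y, bad x y}`.  (Peel a maximal good set `I`: `#I ≤ 4` and every point outside `I` has a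
bad partner inside, giving `#(X ∖ I)` ordered bad pairs with second coordinate in `I`; induct on `X ∖ I`.) [folklore] -/
theorem sq_le_card_badPairs {α : Type*} [DecidableEq α] (bad : α → α → Prop) [DecidableRel bad]
    (hsymm : ∀ x y, bad x y → bad y x) :
    ∀ (X : Finset α), (∀ I ⊆ X, (∀ x ∈ I, ∀ y ∈ I, x ≠ y → ¬ bad x y) → I.card ≤ 4) →
      (X.card - 4) * (X.card - 4) ≤ 8 * ((X ×ˢ X).filter fun p => p.1 ≠ p.2 ∧ bad p.1 p.2).card := by
  intro X
  induction X using Finset.strongInduction with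
  | H X ih =>
    intro hgood
    rcases Nat.lt_or_ge X.card 5 with hsmall | hbig
    · have : X.card - 4 = 0 ∨ X.card - 4 = 1 := by omega
      rcases this with h | h
      · simp [h]
      · -- `#X = 5`: some pair is bad
        have hX5 : X.card = 5 := by omega
        have : ¬ (∀ x ∈ X, ∀ y ∈ X, x ≠ y → ¬ bad x y) := fun hall => by
          have := hgood X le_rfl hall; omega
        push Not at this
        obtain ⟨x, hx, y, hy, hne, hb⟩ := this
        have hmem : (x, y) ∈ (X ×ˢ X).filter fun p => p.1 ≠ p.2 ∧ bad p.1 p.2 :=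
          Finset.mem_filter.2 ⟨Finset.mem_product.2 ⟨hx, hy⟩, hne, hb⟩
        have hpos : 1 ≤ ((X ×ˢ X).filter fun p => p.1 ≠ p.2 ∧ bad p.1 p.2).card :=
          Finset.card_pos.2 ⟨_, hmem⟩
        rw [h]; omega
    · -- a maximal good subset
      set goods := X.powerset.filter (fun I => ∀ x ∈ I, ∀ y ∈ I, x ≠ y → ¬ bad x y) with hgoods
      have hne : goods.Nonempty := ⟨∅, by simp [hgoods]⟩
      obtain ⟨I, hI, hImax⟩ := Finset.exists_max_image goods Finset.card hne
      rw [hgoods, Finset.mem_filter, Finset.mem_powerset] at hI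
      obtain ⟨hIX, hIgood⟩ := hI
      have hI4 : I.card ≤ 4 := hgood I hIX hIgood
      -- `I` is nonempty (singletons are good)
      obtain ⟨x₀, hx₀⟩ : X.Nonempty := Finset.card_pos.1 (by omega)
      have hI1 : 1 ≤ I.card := by
        have h1 : ({x₀} : Finset α) ∈ goods := by
          rw [hgoods, Finset.mem_filter, Finset.mem_powerset]
          exact ⟨Finset.singleton_subset_iff.2 hx₀, fun x hx y hy hxy => absurd
            ((Finset.mem_singleton.1 hx).trans (Finset.mem_singleton.1 hy).symm) hxy⟩
        have := hImax _ h1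
        simpa using this
      -- every point outside `I` has a bad partner in `I`
      have hpartner : ∀ x ∈ X \ I, ∃ i ∈ I, bad x i := by
        intro x hx
        rw [Finset.mem_sdiff] at hx
        by_contra hno
        push Not at hno
        have hins : insert x I ∈ goods := by
          rw [hgoods, Finset.mem_filter, Finset.mem_powerset]
          refine ⟨Finset.insert_subset hx.1 hIX, fun a ha b hb hab => ?_⟩
          rw [Finset.mem_insert] at ha hb
          rcases ha with ha | ha <;> rcases hb with hb | hb
          · exact absurd (ha.trans hb.symm) hab
          · rw [ha]; exact hno b hb
          · rw [hb]; exact fun h => hno a ha (hsymm _ _ h)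
          · exact hIgood a ha b hb hab
        have := hImax _ hins
        rw [Finset.card_insert_of_notMem hx.2] at this
        omega
      choose! prt hprtI hprtbad using hpartner
      -- the new bad pairs `(x, prt x)`, `x ∉ I`, and the old ones inside `X \ I`
      set X' := X \ I with hX'
      set BP := (X ×ˢ X).filter (fun p => p.1 ≠ p.2 ∧ bad p.1 p.2) with hBP
      set BP' := (X' ×ˢ X').filter (fun p => p.1 ≠ p.2 ∧ bad p.1 p.2) with hBP'
      set NEW := X'.image (fun x => (x, prt x)) with hNEW
      have hX'card : X'.card = X.card - I.card := by rw [hX', Finset.card_sdiff_of_subset hIX]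
      have hNEWcard : NEW.card = X'.card :=
        Finset.card_image_of_injOn fun x _ y _ h => (Prod.mk.inj h).1
      have hsub : NEW ∪ BP' ⊆ BP := by
        intro p hp
        rcases Finset.mem_union.1 hp with hp | hp
        · obtain ⟨x, hx, rfl⟩ := Finset.mem_image.1 hp
          have hxX : x ∈ X := (Finset.mem_sdiff.1 hx).1
          have hxI : x ∉ I := (Finset.mem_sdiff.1 hx).2
          refine Finset.mem_filter.2 ⟨Finset.mem_product.2 ⟨hxX, hIX (hprtI x hx)⟩, ?_, hprtbad x hx⟩
          intro h
          simp only at h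
          exact hxI (h ▸ hprtI x hx)
        · rw [hBP', Finset.mem_filter, Finset.mem_product] at hp
          exact Finset.mem_filter.2 ⟨Finset.mem_product.2 ⟨(Finset.mem_sdiff.1 hp.1.1).1,
            (Finset.mem_sdiff.1 hp.1.2).1⟩, hp.2⟩
      have hdisj : Disjoint NEW BP' := by
        rw [Finset.disjoint_left]
        intro p hp hp'
        obtain ⟨x, hx, rfl⟩ := Finset.mem_image.1 hp
        rw [hBP', Finset.mem_filter, Finset.mem_product] at hp'
        exact (Finset.mem_sdiff.1 hp'.1.2).2 (hprtI x hx)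
      have hcardBP : X'.card + BP'.card ≤ BP.card := by
        calc X'.card + BP'.card = (NEW ∪ BP').card := by rw [Finset.card_union_of_disjoint hdisj, hNEWcard]
          _ ≤ BP.card := Finset.card_le_card hsub
      -- induction hypothesis on `X'`
      have hlt : X' ⊂ X := by
        rw [hX']
        refine Finset.sdiff_ssubset hIX ?_
        exact Finset.card_pos.1 (by omega)
      have ih' := ih X' hlt (fun J hJ hJgood => hgood J (hJ.trans Finset.sdiff_subset) hJgood)
      have hXeq : X.card = X'.card + I.card := by
        rw [hX'card]; have := Finset.card_le_card hIX; omega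
      have := peel_arith X'.card I.card BP'.card hI4 ih'
      rw [hXeq]
      omega

end Summit.ValiantsHypothesis.ValiantsHypothesis.Theorems.NewtonUnitEquations.TwoProducts.PlanarCell
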